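import Mathlib
import Summits.NavierStokesRegularity.NavierStokesRegularity.Theorems.EulerZoomLiouvillePowerGaugeEulerLiouvilleHoopCircleAvgCalculus

/-!
# HOOP LINE, plate `CircleJensen` (nsreg-p2 g38 ROUND-48 «EVERY LINE, EVERY BEND», r48/Sketch48.lean `NsregP2.R48.CircleJensen`; LEAD 19832 g14 by name)

Class-free plate for crux `EulerZoomLiouville.PowerGaugeEulerLiouville` (stmt-NavierStokesRegularity-19832), `--supports stmt-NavierStokesRegularity-19832 --as helper`:
**`circleJensen`** — for continuous `P : ℝ³ → ℝ`, every height `s` and radius `t > 0`,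
`|circleAvg P s t|^{3/2} ≤ circleAvg (y ↦ |P y|^{3/2}) s t` (Jensen for the convex `x ↦ x^{3/2}` on `[0,∞)` over the uniform probability on the circle, after
`|⨍ g| ≤ ⨍ |g|`).  USE (R48 §2): with the cylindrical Tonelli formula of `…HoopCylinder` (ns-sfl-p1 g7) it prices a FAT pressure ridge (`⟨P′ − c₀⟩_θ(σ,T) ≥ ησ²` on a set
of heights) by the class's (D) budget `∫|P′−c₀|^{3/2}‖y‖^{2ρ−2}` — the thin/fat ridge dichotomy that confines the curved hoop law to the moderate window.
WHAT THIS IS NOT: not NS, not E — an inequality; 19832 OPEN; NS regularity NOT proved. [folklore (Jensen)]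
-/

noncomputable section

open Set Function MeasureTheory intervalIntegral
open scoped InnerProductSpace RealInnerProductSpace

set_option linter.dupNamespace false

namespace Summit.NavierStokesRegularity.NavierStokesRegularity.Theorems.PowerGaugeEulerLiouville.HoopCore

open Literature.Analysis Literature.Analysis.FluidPDE

/-- The azimuthal average as an honest average over `Ioc 0 (2π)`: `circleAvg f s t = ⨍ θ ∈ (0, 2π], f (axisPt s t θ)`. [folklore] -/
theorem circleAvg_eq_setAverage (f : EuclideanSpace ℝ (Fin 3) → ℝ) (s t : ℝ) :
    circleAvg f s t = ⨍ θ in Ioc (0 : ℝ) (2 * Real.pi), f (axisPt s t θ) := by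
  have h2π : (0 : ℝ) ≤ 2 * Real.pi := by positivity
  rw [setAverage_eq, Real.volume_real_Ioc, max_eq_left (by linarith), circleAvg,
    intervalIntegral.integral_of_le h2π, smul_eq_mul, sub_zero, one_div]

/-- **CIRCLE JENSEN** (`NsregP2.R48.CircleJensen` of nsreg-p2 g38's Sketch48, by name over `HoopCore.circleAvg`): for continuous `P`, `t > 0` and every `s`,
`|⟨P⟩_θ(s,t)|^{3/2} ≤ ⟨|P|^{3/2}⟩_θ(s,t)`. [folklore (Jensen's inequality for `x ↦ x^{3/2}` on `[0, ∞)`)] -/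
theorem circleJensen :
    ∀ (P : EuclideanSpace ℝ (Fin 3) → ℝ), Continuous P → ∀ (s t : ℝ), 0 < t →
      |circleAvg P s t| ^ ((3 : ℝ) / 2) ≤ circleAvg (fun y => |P y| ^ ((3 : ℝ) / 2)) s t := by
  intro P hP s t _ht
  have h2π : (0 : ℝ) < 2 * Real.pi := by positivity
  set μ : Measure ℝ := volume.restrict (Ioc (0 : ℝ) (2 * Real.pi)) with hμ
  haveI : IsFiniteMeasure μ := by
    rw [hμ]; exact isFiniteMeasure_restrict.2 measure_Ioc_lt_top.ne
  have hμ0 : μ ≠ 0 := by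
    rw [hμ, Ne, Measure.restrict_eq_zero, Real.volume_Ioc, ENNReal.ofReal_eq_zero, not_le]
    linarith
  haveI : NeZero μ := ⟨hμ0⟩
  -- the continuous integrands along the circle
  set g : ℝ → ℝ := fun θ => P (axisPt s t θ) with hg
  have hgc : Continuous g := hP.comp (continuous_axisPt_angle s t)
  have hgi : Integrable (fun θ => |g θ|) μ := by
    rw [hμ]; exact (hgc.abs.integrableOn_Icc).mono_set Ioc_subset_Icc_self
  have hgi' : Integrable ((fun x : ℝ => x ^ ((3 : ℝ) / 2)) ∘ fun θ => |g θ|) μ := by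
    rw [hμ]
    have hc : Continuous fun θ => |g θ| ^ ((3 : ℝ) / 2) :=
      hgc.abs.rpow_const fun _ => Or.inr (by norm_num)
    exact (hc.integrableOn_Icc).mono_set Ioc_subset_Icc_self
  -- Jensen for `x ↦ x^{3/2}` on `[0, ∞)`
  have hconv : ConvexOn ℝ (Ici (0 : ℝ)) (fun x : ℝ => x ^ ((3 : ℝ) / 2)) := convexOn_rpow (by norm_num)
  have hcont : ContinuousOn (fun x : ℝ => x ^ ((3 : ℝ) / 2)) (Ici (0 : ℝ)) :=
    fun x _ => (Real.continuousAt_rpow_const x _ (Or.inr (by norm_num))).continuousWithinAt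
  have hJ := hconv.map_average_le hcont isClosed_Ici (Filter.Eventually.of_forall fun θ => abs_nonneg (g θ)) hgi hgi'
  -- rewrite both circle averages as averages over `Ioc 0 (2π)`
  have hL : |circleAvg P s t| ≤ ⨍ θ, |g θ| ∂μ := by
    rw [circleAvg_eq_setAverage, hμ, average_eq, average_eq, smul_eq_mul, smul_eq_mul, abs_mul,
      abs_of_nonneg (by positivity : (0 : ℝ) ≤ _)]
    exact mul_le_mul_of_nonneg_left (abs_integral_le_integral_abs (μ := volume.restrict (Ioc (0 : ℝ) (2 * Real.pi))))
      (by positivity)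
  have hR : circleAvg (fun y => |P y| ^ ((3 : ℝ) / 2)) s t = ⨍ θ, |g θ| ^ ((3 : ℝ) / 2) ∂μ := by
    rw [circleAvg_eq_setAverage, hμ]
  calc |circleAvg P s t| ^ ((3 : ℝ) / 2) ≤ (⨍ θ, |g θ| ∂μ) ^ ((3 : ℝ) / 2) :=
        Real.rpow_le_rpow (abs_nonneg _) hL (by norm_num)
    _ ≤ ⨍ θ, |g θ| ^ ((3 : ℝ) / 2) ∂μ := hJ
    _ = circleAvg (fun y => |P y| ^ ((3 : ℝ) / 2)) s t := hR.symm

end Summit.NavierStokesRegularity.NavierStokesRegularity.Theorems.PowerGaugeEulerLiouville.HoopCore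

end
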